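import Literature.NumberTheory.Automorphic.LocalComponentBJGenericProofs
import Literature.NumberTheory.Automorphic.GLnCuspidalSpectrumFlathProofs
import Literature.NumberTheory.Automorphic.LocalComponentTransposeInv
import Literature.NumberTheory.Automorphic.RankinSelbergLocalEquiv
import Literature.NumberTheory.Automorphic.CuspidalGL2LocalEulerFactor
import Literature.NumberTheory.Automorphic.PAdicRepsJacquetAdmissibilityHolds
import HarnessLib

/-!
# The local Euler polynomials of a clean cuspidal `GL₂`-datum are those of the `L²` local
# components of its `L²` realisation (Flath uniqueness; Borel–Jacquet 1979, 4.6)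

Topic `Literature/NumberTheory/Automorphic`; proof file (theorems only: no definition, no named
fact, no instance).

A brick of the remaining analytic package `(IR)` for CLEAN `A_G`-invariant cuspidal data of
`GL₂(𝔸_K)` (`GlobalHeckeTheoryGL2OfClean`:
`JacquetLanglands1970_standardLTheoryGL2_of_integralRepresentation_clean`, hence the named facts
`JacquetLanglands1970_standardLTheoryGL2`, `JacquetLanglands1970_twistedHeckeTheoryGL2` and
`frobSatakeCompatibleAt_of_isPiOfArtinRep_of_isUnramifiedAt`).  Its hypotheses `hP`, `hP'` pin the
polynomials `P u`, `P' u` as the Rankin–Selberg `L`-polynomials (`HasRSLFactor`, pair `(2, 1)` with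
the trivial representation of `GL₁`) of the Borel–Jacquet local components of `π` and of `π^τ`
(`AutomorphicRepData.HasLocalComponentAt`, `CuspidalAutomorphicRepData.transposeInv`); the Euler
factorisation of the global Hecke integral, on the other hand, is carried out in the `L²` currency
(`CuspidalAutomorphicRepGL`, `JPSSGlobalIntegral`, Flath's `Π ≅ ⊗' Π_v`), where the local factor at a
finite place `u` is an irreducible smooth `L²` local component `ρ` of the realisation `Π` of `π`
(`Automorphic.HasLocalComponentAt Π u ρ`: a non-zero `GL₂(K_u)`-map `V_ρ → Π` along `ι_u`).  This
file transfers `hP`, `hP'` to that currency: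

* `hasRSLFactor_of_isAssociatedL2_of_hasLocalComponentAt` (**main**) — if `π = W / ⊥` is clean and
  associated with `Π ≤ L²_cusp` (`IsAssociatedL2 π Π`), and `hP` holds for `π`, then EVERY irreducible
  smooth `L²` local component `ρ` of `Π` at `u` has `HasRSLFactor (1<2) ρ 1 ψ ν (P u)` (for all
  continuous non-trivial `ψ` and invariant `ν`): a Borel–Jacquet local component `π_u` of `π` exists
  (`exists_hasLocalComponentAt_of_isAdmissible`), is an `L²` local component of `Π`
  (`HasLocalComponentAt.toL2`), both are admissible (Jacquet, `jacquetAdmissibility_gl_holds`), hence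
  `π_u ≅ ρ` by Flath's uniqueness of local components (`nonempty_equiv_of_hasLocalComponentAt_holds`),
  and `HasRSLFactor` is an isomorphism invariant (`hasRSLFactor_iff_of_equiv_left`);
* `hasRSLFactor_comp_glTransposeInv_of_isAssociatedL2_of_hasLocalComponentAt` — dually, if `hP'`
  holds for `π^τ`, then for every irreducible smooth `L²` local component `ρ` of `Π` at `u` the
  transpose-inverse twist `ρ ∘ ι` (`ι(g) = ᵗg⁻¹`; the representation whose Whittaker functions are
  the `W̃` of the dual zeta integrals, `tildeFn`) has `HasRSLFactor (1<2) (ρ ∘ ι) 1 ψ ν (P' u)`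
  (`CuspidalAutomorphicRepData.hasLocalComponentAt_transposeInv`: `π_u ∘ τ_u` is a local component of
  `π^τ`; `hasRSLFactor_comp_conj_glTransposeInv_iff`: `ρ ∘ τ_u ≅ ρ ∘ ι`).

(Borel–Jacquet 1979, 4.6: "the two notions of automorphic representation coincide for cuspidal
representations"; Flath 1979, Thm. 3–4; Jacquet–Langlands 1970, proof of Thm. 11.1, p. 172:
`Ψ(g, s, φ) = ∏_v Ψ(g_v, s, φ_v)` with `Φ(g_v, s, φ_v) = Ψ / L(s, π_v)`.)

## References

* A. Borel, H. Jacquet, *Automorphic forms and automorphic representations*, Corvallis 1979,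
  §4.6. [BorelJacquetCorvallis1979]
* D. Flath, *Decomposition of representations into tensor products*, Corvallis 1979, Thm. 3–4.
  [FlathCorvallis1979]
* H. Jacquet, R. P. Langlands, *Automorphic Forms on GL(2)*, LNM 114 (1970), proof of Thm. 11.1.
  [JacquetLanglands1970]
-/

noncomputable section

open scoped MatrixGroups NNReal Classical
open MeasureTheory NumberField IsDedekindDomain Polynomial

namespace Literature.NumberTheory.Automorphic

open GaloisRepresentations (glTransposeInv)

variable {K : Type} [Field K] [NumberField K] {hcpt : isCompact_glFiniteIntegralLevel 2 K}
  {μ : Measure (AdelicGroupData.gl 2 K).automorphicQuotient}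
  [(AdelicGroupData.gl 2 K).IsAutomorphicMeasure μ]

/-! ### The `π`-side: `L(s, Π_u) = (P u)(q_u^{-s})⁻¹` for every `L²` local component `Π_u` -/

/-- **The local Euler polynomials of a clean cuspidal `GL₂`-datum are those of the `L²` local
components of its `L²` realisation.** Let `π = W / ⊥` be a clean cuspidal Borel–Jacquet datum of
`GL₂(𝔸_K)` associated with `Π ≤ L²_cusp(GL₂(𝔸_K) ⧸ A_G GL₂(K), μ)`, and suppose that every
Borel–Jacquet local component of `π` at `u` has the Rankin–Selberg `L`-polynomial `P u` (pair
`(2, 1)`, trivial representation of `GL₁`, every continuous non-trivial `ψ`, every invariant `ν`).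
Then so does every irreducible smooth `L²` local component `ρ` of `Π` at `u`.
[cite: BorelJacquetCorvallis1979, §4.6] [cite: FlathCorvallis1979, Thm. 3] -/
theorem hasRSLFactor_of_isAssociatedL2_of_hasLocalComponentAt
    {π : CuspidalAutomorphicRepData 2 K hcpt} {Pl : CuspidalAutomorphicRepGL 2 K μ}
    (hbot : π.1.W' = ⊥) (hass : IsAssociatedL2 π Pl) {P : HeightOneSpectrum (𝓞 K) → ℂ[X]}
    (hP : ∀ (u : HeightOneSpectrum (𝓞 K)) (πu : SmoothIrrep (GL (Fin 2) (u.adicCompletion K))),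
      π.1.HasLocalComponentAt u πu.ρ →
      ∀ (ψ : AddChar (u.adicCompletion K) Circle), ψ.IsContinuousNontrivial →
      ∀ [MeasurableSpace (u.adicCompletion K)] [BorelSpace (u.adicCompletion K)]
        [MeasurableSpace (GL (Fin 1) (u.adicCompletion K) ⧸ upperUnitriangular (Fin 1) (u.adicCompletion K))]
        [BorelSpace (GL (Fin 1) (u.adicCompletion K) ⧸ upperUnitriangular (Fin 1) (u.adicCompletion K))]
        (ν : Measure (GL (Fin 1) (u.adicCompletion K) ⧸ upperUnitriangular (Fin 1) (u.adicCompletion K)))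
        [SMulInvariantMeasure (GL (Fin 1) (u.adicCompletion K))
          (GL (Fin 1) (u.adicCompletion K) ⧸ upperUnitriangular (Fin 1) (u.adicCompletion K)) ν]
        [IsFiniteMeasureOnCompacts ν] [ν.IsOpenPosMeasure],
        HasRSLFactor Nat.one_lt_two πu.ρ
          (Representation.trivial ℂ (GL (Fin 1) (u.adicCompletion K)) ℂ) ψ ν (P u))
    (u : HeightOneSpectrum (𝓞 K)) {V : Type} [AddCommGroup V] [Module ℂ V]
    {ρ : Representation ℂ (GL (Fin 2) (u.adicCompletion K)) V} (hρi : ρ.IsIrreducible)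
    (hρs : ρ.IsSmooth) (hρ : Automorphic.HasLocalComponentAt Pl.1 u ρ)
    (ψ : AddChar (u.adicCompletion K) Circle) (hψ : ψ.IsContinuousNontrivial)
    [MeasurableSpace (u.adicCompletion K)] [BorelSpace (u.adicCompletion K)]
    [MeasurableSpace (GL (Fin 1) (u.adicCompletion K) ⧸ upperUnitriangular (Fin 1) (u.adicCompletion K))]
    [BorelSpace (GL (Fin 1) (u.adicCompletion K) ⧸ upperUnitriangular (Fin 1) (u.adicCompletion K))]
    (ν : Measure (GL (Fin 1) (u.adicCompletion K) ⧸ upperUnitriangular (Fin 1) (u.adicCompletion K)))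
    [SMulInvariantMeasure (GL (Fin 1) (u.adicCompletion K))
      (GL (Fin 1) (u.adicCompletion K) ⧸ upperUnitriangular (Fin 1) (u.adicCompletion K)) ν]
    [IsFiniteMeasureOnCompacts ν] [ν.IsOpenPosMeasure] :
    HasRSLFactor Nat.one_lt_two ρ (Representation.trivial ℂ (GL (Fin 1) (u.adicCompletion K)) ℂ)
      ψ ν (P u) := by
  -- a Borel–Jacquet local component `π_u`, with the polynomial `P u`
  obtain ⟨πu, hloc⟩ := AutomorphicRepData.exists_hasLocalComponentAt_of_isAdmissible
    (automorphicRep_isAdmissible_holds hcpt) π.1 u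
  have hPu := hP u πu hloc ψ hψ ν
  -- it is an `L²` local component of `Π`, admissible, hence isomorphic to `ρ`
  have hL2 : Automorphic.HasLocalComponentAt Pl.1 u πu.ρ :=
    AutomorphicRepData.HasLocalComponentAt.toL2 hbot hass hloc
  have hadm : πu.ρ.IsAdmissible :=
    jacquetAdmissibility_gl_holds (u.adicCompletion K) 2 πu.V πu.ρ πu.isSmooth πu.isIrreducible
  have hadmρ : ρ.IsAdmissible := jacquetAdmissibility_gl_holds (u.adicCompletion K) 2 V ρ hρs hρi
  obtain ⟨e⟩ := nonempty_equiv_of_hasLocalComponentAt_holds Pl u πu.isIrreducible hadm hL2 hρi hadmρ hρ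
  exact (hasRSLFactor_iff_of_equiv_left e (P u)).1 hPu

/-! ### The `π^τ`-side: `L(s, Π_u ∘ ι) = (P' u)(q_u^{-s})⁻¹` -/

/-- **Dual version.** With `π`, `Π` as above, suppose that every Borel–Jacquet local component of
the transpose-inverse twist `π^τ` at `u` has the Rankin–Selberg `L`-polynomial `P' u`. Then for
every irreducible smooth `L²` local component `ρ` of `Π` at `u`, the twist `ρ ∘ ι` (`ι(g) = ᵗg⁻¹`)
has the `L`-polynomial `P' u`: a Borel–Jacquet local component `π_u ≅ ρ` of `π` gives the local
component `π_u ∘ τ_u` of `π^τ` (`τ_u = w₀ ᵗ(·)⁻¹ w₀`), and `π_u ∘ τ_u ≅ π_u ∘ ι ≅ ρ ∘ ι`.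
[cite: JacquetLanglands1970, Thm. 11.1 (proof)] [cite: FlathCorvallis1979, Thm. 3] -/
theorem hasRSLFactor_comp_glTransposeInv_of_isAssociatedL2_of_hasLocalComponentAt
    {π : CuspidalAutomorphicRepData 2 K hcpt} {Pl : CuspidalAutomorphicRepGL 2 K μ}
    (hbot : π.1.W' = ⊥) (hass : IsAssociatedL2 π Pl) {P' : HeightOneSpectrum (𝓞 K) → ℂ[X]}
    (hP' : ∀ (u : HeightOneSpectrum (𝓞 K)) (πu : SmoothIrrep (GL (Fin 2) (u.adicCompletion K))),
      π.transposeInv.1.HasLocalComponentAt u πu.ρ →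
      ∀ (ψ : AddChar (u.adicCompletion K) Circle), ψ.IsContinuousNontrivial →
      ∀ [MeasurableSpace (u.adicCompletion K)] [BorelSpace (u.adicCompletion K)]
        [MeasurableSpace (GL (Fin 1) (u.adicCompletion K) ⧸ upperUnitriangular (Fin 1) (u.adicCompletion K))]
        [BorelSpace (GL (Fin 1) (u.adicCompletion K) ⧸ upperUnitriangular (Fin 1) (u.adicCompletion K))]
        (ν : Measure (GL (Fin 1) (u.adicCompletion K) ⧸ upperUnitriangular (Fin 1) (u.adicCompletion K)))
        [SMulInvariantMeasure (GL (Fin 1) (u.adicCompletion K))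
          (GL (Fin 1) (u.adicCompletion K) ⧸ upperUnitriangular (Fin 1) (u.adicCompletion K)) ν]
        [IsFiniteMeasureOnCompacts ν] [ν.IsOpenPosMeasure],
        HasRSLFactor Nat.one_lt_two πu.ρ
          (Representation.trivial ℂ (GL (Fin 1) (u.adicCompletion K)) ℂ) ψ ν (P' u))
    (u : HeightOneSpectrum (𝓞 K)) {V : Type} [AddCommGroup V] [Module ℂ V]
    {ρ : Representation ℂ (GL (Fin 2) (u.adicCompletion K)) V} (hρi : ρ.IsIrreducible)
    (hρs : ρ.IsSmooth) (hρ : Automorphic.HasLocalComponentAt Pl.1 u ρ)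
    (ψ : AddChar (u.adicCompletion K) Circle) (hψ : ψ.IsContinuousNontrivial)
    [MeasurableSpace (u.adicCompletion K)] [BorelSpace (u.adicCompletion K)]
    [MeasurableSpace (GL (Fin 1) (u.adicCompletion K) ⧸ upperUnitriangular (Fin 1) (u.adicCompletion K))]
    [BorelSpace (GL (Fin 1) (u.adicCompletion K) ⧸ upperUnitriangular (Fin 1) (u.adicCompletion K))]
    (ν : Measure (GL (Fin 1) (u.adicCompletion K) ⧸ upperUnitriangular (Fin 1) (u.adicCompletion K)))
    [SMulInvariantMeasure (GL (Fin 1) (u.adicCompletion K))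
      (GL (Fin 1) (u.adicCompletion K) ⧸ upperUnitriangular (Fin 1) (u.adicCompletion K)) ν]
    [IsFiniteMeasureOnCompacts ν] [ν.IsOpenPosMeasure] :
    HasRSLFactor Nat.one_lt_two (ρ.comp (glTransposeInv (Fin 2) (u.adicCompletion K)).toMonoidHom)
      (Representation.trivial ℂ (GL (Fin 1) (u.adicCompletion K)) ℂ) ψ ν (P' u) := by
  -- a Borel–Jacquet local component `π_u ≅ ρ` of `π` (as in the `π`-side)
  obtain ⟨πu, hloc⟩ := AutomorphicRepData.exists_hasLocalComponentAt_of_isAdmissible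
    (automorphicRep_isAdmissible_holds hcpt) π.1 u
  have hL2 : Automorphic.HasLocalComponentAt Pl.1 u πu.ρ :=
    AutomorphicRepData.HasLocalComponentAt.toL2 hbot hass hloc
  have hadm : πu.ρ.IsAdmissible :=
    jacquetAdmissibility_gl_holds (u.adicCompletion K) 2 πu.V πu.ρ πu.isSmooth πu.isIrreducible
  have hadmρ : ρ.IsAdmissible := jacquetAdmissibility_gl_holds (u.adicCompletion K) 2 V ρ hρs hρi
  obtain ⟨e⟩ := nonempty_equiv_of_hasLocalComponentAt_holds Pl u πu.isIrreducible hadm hL2 hρi hadmρ hρ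
  -- `π_u ∘ τ_u` is a local component of `π^τ` (`τ_u = w₀ ᵗ(·)⁻¹ w₀`), irreducible and smooth
  set τu : GL (Fin 2) (u.adicCompletion K) →* GL (Fin 2) (u.adicCompletion K) :=
    (MulAut.conj (weylLong 2 (u.adicCompletion K))).toMonoidHom.comp
      (glTransposeInv (Fin 2) (u.adicCompletion K)).toMonoidHom with hτu
  have hlocτ : π.transposeInv.1.HasLocalComponentAt u (πu.ρ.comp τu) :=
    CuspidalAutomorphicRepData.hasLocalComponentAt_transposeInv π hloc
  obtain ⟨eτ⟩ := nonempty_equiv_comp_conj_glTransposeInv (R := u.adicCompletion K) πu.ρ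
  have hirrι : Representation.IsIrreducible
      (πu.ρ.comp (glTransposeInv (Fin 2) (u.adicCompletion K)).toMonoidHom) :=
    (isIrreducible_twist_iff (π := πu.ρ)).2 πu.isIrreducible
  have hirrτ : Representation.IsIrreducible (πu.ρ.comp τu) := eτ.isIrreducible_iff.2 hirrι
  have hconj : Continuous fun g : GL (Fin 2) (u.adicCompletion K) =>
      MulAut.conj (weylLong 2 (u.adicCompletion K)) g := by
    simp only [MulAut.conj_apply]
    exact (continuous_const.mul continuous_id).mul continuous_const
  have hτu_cont : Continuous τu :=
    hconj.comp (map_continuous (glTransposeInv (Fin 2) (u.adicCompletion K)))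
  have hsmτ : Representation.IsSmooth (πu.ρ.comp τu) := by
    intro v
    have hset : ((Representation.stabilizerSubgroup (πu.ρ.comp τu) v :
        Subgroup (GL (Fin 2) (u.adicCompletion K))) : Set (GL (Fin 2) (u.adicCompletion K))) =
        τu ⁻¹' (πu.ρ.stabilizerSubgroup v : Set (GL (Fin 2) (u.adicCompletion K))) := by
      ext g
      simp [Representation.mem_stabilizerSubgroup]
    rw [Representation.isSmoothVector_iff, hset]
    exact (πu.isSmooth v).preimage hτu_cont
  -- the polynomial `P' u` of `π_u ∘ τ_u`, hence of `π_u ∘ ι ≅ ρ ∘ ι`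
  have hP'u : HasRSLFactor Nat.one_lt_two (πu.ρ.comp τu)
      (Representation.trivial ℂ (GL (Fin 1) (u.adicCompletion K)) ℂ) ψ ν (P' u) :=
    hP' u ⟨πu.V, πu.ρ.comp τu, hirrτ, hsmτ⟩ hlocτ ψ hψ ν
  have hιu : HasRSLFactor Nat.one_lt_two
      (πu.ρ.comp (glTransposeInv (Fin 2) (u.adicCompletion K)).toMonoidHom)
      (Representation.trivial ℂ (GL (Fin 1) (u.adicCompletion K)) ℂ) ψ ν (P' u) :=
    (hasRSLFactor_iff_of_equiv_left eτ (P' u)).1 hP'u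
  -- `e : π_u ≃ ρ` is also an isomorphism `π_u ∘ ι ≃ ρ ∘ ι`
  have eι : Representation.Equiv (πu.ρ.comp (glTransposeInv (Fin 2) (u.adicCompletion K)).toMonoidHom)
      (ρ.comp (glTransposeInv (Fin 2) (u.adicCompletion K)).toMonoidHom) :=
    Representation.Equiv.mk e.toLinearEquiv fun g => by
      rw [MonoidHom.comp_apply, MonoidHom.comp_apply]
      exact e.isIntertwining' _
  exact (hasRSLFactor_iff_of_equiv_left eι (P' u)).1 hιu

end Literature.NumberTheory.Automorphic

end
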